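import Mathlib.Analysis.InnerProductSpace.PiL2
import Mathlib.Analysis.SpecialFunctions.Complex.Arg
import Mathlib.Analysis.SpecialFunctions.Trigonometric.Inverse
import Literature.Geometry.DiscreteGeometry.SphericalCodeIrreducible
import HarnessLib

/-!
# The star of a jammed vertex: tangent half-planes, cyclic order of the contacts, gap angles
# (Musin–Tarasov 2012, §3.2 and Proposition 3.6 (i)–(iii), in vertex form) — proved

Topic `Literature/Geometry/DiscreteGeometry`; brick 4, in printed order, of the proof of
Theorem 1 of O. R. Musin, A. S. Tarasov, *The strong thirteen spheres problem*, Discrete Comput.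
Geom. 48 (2012) 128–141 [`MusinTarasov2012`] (named fact `musinTarasov2012_tammes_thirteen`),
after `SphericalCodeContactGraph.lean`, `SphericalCodeOptimal.lean`, `RankinOrthoplexBound.lean`
and `SphericalCodeIrreducible.lean` (Propositions 3.1–3.3, irreducibility).  §3.2 of the paper
parametrises an irreducible contact graph by "the set of all angles `uᵢ` of its faces and
`d := ψ(X)`" and records (Proposition 3.6): `uᵢ < π`; `uᵢ ≥ α(ψ(X))`; `Σ_{k ∈ I(v)} u_k = 2π` at
every vertex `v`.  The angles `u_k`, `k ∈ I(v)`, are the angles at `v` between CYCLICALLY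
CONSECUTIVE contact edges — a notion that needs no faces.  This file defines them (the "gap
angles" of the vertex star) and PROVES all three constraints for the maximal arrangements with
the fewest edges; everything is a definition or proved, no named facts.

## Source (verbatim, arXiv:1002.1439v3, §3.2)

"Let `X ⊂ S²` with `|X| = 13`. Let the graph `CG(X)` be irreducible. Note that all faces of
`CG(X)` are convex polygons. (Otherwise, a 'concave' vertex of a polygon `P` can be shifted to the
interior of `P`.) […] Consider as parameters (variables) of `CG(X)` in `S²` the set of all angles
`uᵢ` of its faces and `d := ψ(X)`. […] **Proposition 3.6.** `uᵢ < π` for all `uᵢ`;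
`uᵢ ≥ α(ψ(X))` for all `uᵢ`, where `α(d) := cos⁻¹(cos d/(1 + cos d))` is the angle of a regular
triangle in `S²` with sides of length `d`; `Σ_{k ∈ I(v)} u_k = 2π` for all vertices `v` of `G`,
where `I(v)` is the set of subscripts of angles that are adjacent to `v`."

## What is proved, and in which form

* Part A (any real inner product space): `hasShift_of_tangent_halfplane` — a nonzero tangent
  vector `n` at `x i` with all contact neighbours in the closed half-space `⟪n, ·⟫ ≤ 0` yields a
  shift of `i` when `ψ < √2` (the curve `(x i + εn)/‖x i + εn‖`); hence
  `exists_inner_pos_of_not_hasShift` (**a jammed vertex has a contact strictly inside every open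
  tangent half-plane** — the vector form of "faces are convex" / `uᵢ < π`) and
  `IsTammesOptimal.exists_inner_pos` (`S²`, `N ≥ 7`).
* Part B (`S² ⊂ ℝ³`): `tangentFrame v` (a fixed orthonormal frame with third vector `v`),
  `azimuth v u` (azimuth of `u` at `v`, in `(−π, π]`), `tangentDir v φ` (unit tangent vector
  at azimuth `φ`), and the dictionary for points at level `⟪v, u⟫ = κ`:
  `sq_add_sq_of_inner_eq`, `inner_frame_eq_polar`, **`inner_eq_of_azimuth`**
  (`⟪u, u'⟫ = (1 − κ²) cos(θ − θ') + κ²`), `eq_of_azimuth_eq`, `inner_tangentDir`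
  (`⟪t_φ, u⟫ = √(1−κ²) cos(θ_u − φ)`).
* Part C: the cyclic order — `nbrAngles`, `card_nbrAngles` (`= deg` for injective `x`),
  `sortedAngle` (`e₀ < ⋯ < e_{d−1}`), `nbrAt` (the `m`-th neighbour counter-clockwise; a
  bijection onto `contactNbrs x i`: `nbrAt_mem`, `nbrAt_injective`, `exists_nbrAt_eq`), and
  **the gap angles** `gapAngle … m = e_{m+1} − e_m` (indices mod `d`, `+2π` on the wrap-around
  gap) — these are the `u_k`, `k ∈ I(x i)` — with **`sum_gapAngle` (Prop 3.6 (iii): `Σ = 2π`)**,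
  `cos_gapAngle`, `gapAngle_pos` (`0 < g ≤ 2π`).
* Part D: `cos_gapAngle_eq` (`cos g_m` from the inner product of the two consecutive
  neighbours), **`arccos_le_gapAngle` (Prop 3.6 (ii): `g ≥ α(ψ) = arccos(κ/(1+κ))`)**,
  **`gapAngle_lt_pi` (Prop 3.6 (i): `g < π` at a jammed vertex**, via the bisector of a gap
  `≥ π` and Part A), and the package `IsTammesOptimal.gapAngle_bounds` for maximal arrangements
  with the fewest edges of `N ≥ 7` points of `S²`.

Not here: which gaps at DIFFERENT vertices are angles of the same face (this needs the face
structure of the contact fan — Propositions 3.4–3.5 and §3.2 cases `m = 4, 5, 6`), §§4–5.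

## References

* O. R. Musin, A. S. Tarasov, Discrete Comput. Geom. 48 (2012) 128–141 = arXiv:1002.1439, §3.2
  and Proposition 3.6. [`MusinTarasov2012`]
-/

noncomputable section

namespace Literature.Geometry.DiscreteGeometry

open Real RealInnerProductSpace Finset Filter Topology

/-! ### Part A. A closed tangent half-plane free of contacts gives a shift -/

section HalfPlane

variable {E : Type*} [NormedAddCommGroup E] [InnerProductSpace ℝ E] {N : ℕ}

/-- **Half-plane shift.**  Let `x` be a unit configuration with `ψ(x) < √2`, `i` a label and `n`
a nonzero TANGENT vector at `x i` (`⟪x i, n⟫ = 0`) such that every contact neighbour `x j` of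
`x i` lies in the closed half-space `⟪n, ·⟫ ≤ 0`.  Then `i` admits a shift: for `ε > 0` the unit
vectors `y_ε = (x i + ε n)/‖x i + ε n‖` have `‖x i + ε n‖² = 1 + ε²‖n‖² > 1`, so
`⟪y_ε, x j⟫ = (⟪x i, x j⟫ + ε⟪n, x j⟫)/‖x i + ε n‖ < ⟪x i, x j⟫` for every contact neighbour
(`⟪x i, x j⟫ > 0` as `ψ < √2`), while non-neighbours stay at distance `> ψ` for small `ε`.
This is the mechanism behind "a 'concave' vertex of a polygon `P` can be shifted to the interior
of `P`" (§3.2) and behind the bound `uᵢ < π` of Proposition 3.6 (i).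
[cite: MusinTarasov2012, §3.2 (faces are convex) and Proposition 3.6 (i)] -/
theorem hasShift_of_tangent_halfplane {x : Fin N → E} (hx : x ∈ unitConfigs N E) (i : Fin N)
    (hψ : minDist x < Real.sqrt 2) {n : E} (hn : n ≠ 0) (hnt : ⟪x i, n⟫ = 0)
    (hle : ∀ j ∈ contactNbrs x i, ⟪n, x j⟫ ≤ 0) : HasShift x i := by
  have hψ0 : 0 ≤ minDist x := minDist_nonneg x
  set z : ℝ → E := fun ε => x i + ε • n with hzdef
  have hz2 : ∀ ε, ‖z ε‖ ^ 2 = 1 + ε ^ 2 * ‖n‖ ^ 2 := by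
    intro ε
    rw [hzdef]
    simp only
    rw [norm_add_sq_real, hx i, real_inner_smul_right, hnt, norm_smul, mul_pow,
      Real.norm_eq_abs, sq_abs]
    ring
  have hz1 : ∀ ε, 0 < ε → 1 < ‖z ε‖ := by
    intro ε hε
    have hn2 : 0 < ‖n‖ ^ 2 := by positivity
    have : 1 < ‖z ε‖ ^ 2 := by rw [hz2]; nlinarith [mul_pos (pow_pos hε 2) hn2]
    exact lt_of_pow_lt_pow_left₀ 2 (norm_nonneg _) (by simpa using this)
  set y : ℝ → E := fun ε => ‖z ε‖⁻¹ • z ε with hydef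
  have hy1 : ∀ ε, 0 < ε → ‖y ε‖ = 1 := by
    intro ε hε
    have h0 : ‖z ε‖ ≠ 0 := by linarith [hz1 ε hε]
    rw [hydef]
    simp only
    rw [norm_smul, norm_inv, norm_norm, inv_mul_cancel₀ h0]
  have hcontact : ∀ ε, 0 < ε → ∀ j ∈ contactNbrs x i, minDist x < dist (y ε) (x j) := by
    intro ε hε j hj
    obtain ⟨hji, hdj⟩ := mem_contactNbrs.1 hj
    have hpos : 0 < ⟪x i, x j⟫ :=
      (dist_lt_sqrt_two_iff_inner_pos (hx i) (hx j)).1 (hdj ▸ hψ)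
    have hin : ⟪y ε, x j⟫ = ‖z ε‖⁻¹ * (⟪x i, x j⟫ + ε * ⟪n, x j⟫) := by
      rw [hydef]
      simp only
      rw [real_inner_smul_left, hzdef]
      simp only
      rw [inner_add_left, real_inner_smul_left]
    have hz := hz1 ε hε
    have hzinv : ‖z ε‖⁻¹ < 1 := inv_lt_one_of_one_lt₀ hz
    have hzinv0 : 0 < ‖z ε‖⁻¹ := inv_pos.2 (by linarith)
    have hlt : ⟪y ε, x j⟫ < ⟪x i, x j⟫ := by
      rw [hin]
      have h1 : ⟪x i, x j⟫ + ε * ⟪n, x j⟫ ≤ ⟪x i, x j⟫ := by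
        nlinarith [mul_nonpos_of_nonneg_of_nonpos hε.le (hle j hj)]
      calc ‖z ε‖⁻¹ * (⟪x i, x j⟫ + ε * ⟪n, x j⟫) ≤ ‖z ε‖⁻¹ * ⟪x i, x j⟫ :=
            mul_le_mul_of_nonneg_left h1 hzinv0.le
        _ < 1 * ⟪x i, x j⟫ := mul_lt_mul_of_pos_right hzinv hpos
        _ = ⟪x i, x j⟫ := one_mul _
    have hψj : ⟪x i, x j⟫ = 1 - minDist x ^ 2 / 2 :=
      (dist_eq_iff_inner_eq_of_unit (hx i) (hx j) hψ0).1 hdj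
    exact (lt_dist_iff_inner_lt_of_unit (hy1 ε hε) (hx j) hψ0).2 (by linarith)
  have hcont : Tendsto y (𝓝[>] 0) (𝓝 (x i)) := by
    have hzc : Continuous z := by
      rw [hzdef]; exact continuous_const.add (continuous_id.smul continuous_const)
    have hz0 : z 0 = x i := by rw [hzdef]; simp
    have hnc : ContinuousAt (fun ε => ‖z ε‖⁻¹) 0 := by
      refine (hzc.norm.continuousAt).inv₀ ?_
      rw [hz0, hx i]; exact one_ne_zero
    have hyc : ContinuousAt y 0 := by
      rw [hydef]; exact hnc.smul hzc.continuousAt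
    have hy0 : y 0 = x i := by
      rw [hydef]; simp only; rw [hz0, hx i]; simp
    have := hyc.tendsto
    rw [hy0] at this
    exact this.mono_left nhdsWithin_le_nhds
  have hfar : ∀ᶠ ε in 𝓝[>] (0 : ℝ), ∀ j, j ≠ i → j ∉ contactNbrs x i →
      minDist x < dist (y ε) (x j) := by
    refine eventually_all.2 fun j => ?_
    by_cases hji : j ≠ i
    · by_cases hj : j ∈ contactNbrs x i
      · exact Eventually.of_forall fun ε _ h => absurd hj h
      · have hgt : minDist x < dist (x i) (x j) := by
          refine lt_of_le_of_ne (minDist_le_dist x (Ne.symm hji)) fun h => hj ?_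
          exact mem_contactNbrs.2 ⟨hji, h.symm⟩
        have hopen : IsOpen {w : E | minDist x < dist w (x j)} :=
          isOpen_lt continuous_const (continuous_id.dist continuous_const)
        have hmem : {w : E | minDist x < dist w (x j)} ∈ 𝓝 (x i) := hopen.mem_nhds hgt
        exact (hcont.eventually_mem hmem).mono fun ε hε _ _ => hε
    · exact Eventually.of_forall fun ε h => absurd h hji
  have hpos : ∀ᶠ ε in 𝓝[>] (0 : ℝ), 0 < ε := eventually_nhdsWithin_of_forall fun ε hε => hε
  obtain ⟨ε, hε, hεfar⟩ := (hpos.and hfar).exists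
  refine ⟨y ε, hy1 ε hε, fun j hji => ?_⟩
  by_cases hj : j ∈ contactNbrs x i
  · exact hcontact ε hε j hj
  · exact hεfar j hji hj

/-- **A jammed vertex is surrounded by its contacts** (Proposition 3.6 (i) in vector form): if
the label `i`, of positive degree, admits no shift (e.g. `x` is a maximal arrangement with the
fewest edges, `IsTammesOptimal.not_hasShift`) and `ψ(x) < √2`, then for every nonzero tangent
vector `n` at `x i` some contact neighbour lies strictly on the positive side: `⟪n, x j⟫ > 0`.
Equivalently no closed tangent half-plane contains all contacts, i.e. every angular gap between
consecutive contacts around `x i` is `< π` — the faces at `x i` are convex at `x i`.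
[cite: MusinTarasov2012, Proposition 3.6 (i) and §3.2 ("all faces of CG(X) are convex")] -/
theorem exists_inner_pos_of_not_hasShift {x : Fin N → E} (hx : x ∈ unitConfigs N E) {i : Fin N}
    (hns : ¬ HasShift x i) (hψ : minDist x < Real.sqrt 2) {n : E} (hn : n ≠ 0)
    (hnt : ⟪x i, n⟫ = 0) : ∃ j ∈ contactNbrs x i, 0 < ⟪n, x j⟫ := by
  by_contra h
  push Not at h
  exact hns (hasShift_of_tangent_halfplane hx i hψ hn hnt h)

/-- The same for maximal arrangements with the fewest edges of `N ≥ 7` points of `S²`, at every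
vertex of positive degree. [cite: MusinTarasov2012, Proposition 3.6 (i)] -/
theorem IsTammesOptimal.exists_inner_pos {N : ℕ} {x : Fin N → EuclideanSpace ℝ (Fin 3)}
    (hN : 7 ≤ N) (hopt : IsTammesOptimal N (EuclideanSpace ℝ (Fin 3)) x) {i : Fin N}
    (hdeg : (contactNbrs x i).Nonempty) {n : EuclideanSpace ℝ (Fin 3)} (hn : n ≠ 0)
    (hnt : ⟪x i, n⟫ = 0) : ∃ j ∈ contactNbrs x i, 0 < ⟪n, x j⟫ := by
  obtain ⟨j, hj⟩ := hdeg
  exact exists_inner_pos_of_not_hasShift hopt.mem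
    (hopt.not_hasShift ⟨j, mem_contactNbrs_iff.1 hj⟩) (hopt.minDist_lt_sqrt_two hN) hn hnt

end HalfPlane

/-! ### Part B. Tangent frame, tangent angles and tangent directions at a point of `S²` -/

section Frame

/-- A fixed orthonormal frame of `ℝ³` whose third vector is the unit vector `v` (chosen once and
for all by `exists_orthonormalBasis_third_eq_unit`). [folklore] -/
def tangentFrame (v : EuclideanSpace ℝ (Fin 3)) (hv : ‖v‖ = 1) :
    OrthonormalBasis (Fin 3) ℝ (EuclideanSpace ℝ (Fin 3)) :=
  Classical.choose (exists_orthonormalBasis_third_eq_unit hv)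

/-- Its third vector is `v`. [folklore] -/
theorem tangentFrame_two (v : EuclideanSpace ℝ (Fin 3)) (hv : ‖v‖ = 1) : tangentFrame v hv 2 = v :=
  Classical.choose_spec (exists_orthonormalBasis_third_eq_unit hv)

/-- **The tangent angle** of `u` at `v`: the argument of the tangential component of `u` in the
frame (the azimuth of `u` seen from `v`). [folklore] -/
def azimuth (v : EuclideanSpace ℝ (Fin 3)) (hv : ‖v‖ = 1) (u : EuclideanSpace ℝ (Fin 3)) : ℝ :=
  Complex.arg ⟨⟪tangentFrame v hv 0, u⟫, ⟪tangentFrame v hv 1, u⟫⟩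

/-- `−π < azimuth ≤ π`. [folklore] -/
theorem neg_pi_lt_azimuth (v : EuclideanSpace ℝ (Fin 3)) (hv : ‖v‖ = 1)
    (u : EuclideanSpace ℝ (Fin 3)) : -π < azimuth v hv u := Complex.neg_pi_lt_arg _

/-- `−π < azimuth ≤ π`. [folklore] -/
theorem azimuth_le_pi (v : EuclideanSpace ℝ (Fin 3)) (hv : ‖v‖ = 1)
    (u : EuclideanSpace ℝ (Fin 3)) : azimuth v hv u ≤ π := Complex.arg_le_pi _

/-- **The tangent direction** at azimuth `φ`: the unit tangent vector `cos φ · b₀ + sin φ · b₁`.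
[folklore] -/
def tangentDir (v : EuclideanSpace ℝ (Fin 3)) (hv : ‖v‖ = 1) (φ : ℝ) : EuclideanSpace ℝ (Fin 3) :=
  Real.cos φ • tangentFrame v hv 0 + Real.sin φ • tangentFrame v hv 1

variable {v : EuclideanSpace ℝ (Fin 3)} {hv : ‖v‖ = 1}

/-- Orthonormality of the frame, in `if`-form. [folklore] -/
theorem tangentFrame_inner (i j : Fin 3) :
    ⟪tangentFrame v hv i, tangentFrame v hv j⟫ = if i = j then (1 : ℝ) else 0 := by
  rw [orthonormal_iff_ite.1 (tangentFrame v hv).orthonormal i j]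

/-- The tangent direction is a unit tangent vector: `⟪v, t_φ⟫ = 0`. [folklore] -/
theorem inner_tangentDir_self (φ : ℝ) : ⟪v, tangentDir v hv φ⟫ = 0 := by
  rw [show ⟪v, tangentDir v hv φ⟫ = ⟪tangentFrame v hv 2, tangentDir v hv φ⟫ by
    rw [tangentFrame_two]]
  simp only [tangentDir, inner_add_right, real_inner_smul_right, tangentFrame_inner]
  simp

/-- … of norm `1`. [folklore] -/
theorem norm_tangentDir (φ : ℝ) : ‖tangentDir v hv φ‖ = 1 := by
  have h : ⟪tangentDir v hv φ, tangentDir v hv φ⟫ = 1 := by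
    simp only [tangentDir, inner_add_left, inner_add_right, real_inner_smul_left,
      real_inner_smul_right, tangentFrame_inner]
    simp only [Fin.isValue, ↓reduceIte, mul_one, one_ne_zero, mul_zero, add_zero,
      zero_ne_one, zero_add]
    nlinarith [Real.cos_sq_add_sin_sq φ]
  rw [real_inner_self_eq_norm_sq] at h
  nlinarith [norm_nonneg (tangentDir v hv φ)]

/-- In particular it is nonzero. [folklore] -/
theorem tangentDir_ne_zero (φ : ℝ) : tangentDir v hv φ ≠ 0 := by
  intro h
  have := norm_tangentDir (v := v) (hv := hv) φ
  rw [h, norm_zero] at this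
  exact zero_ne_one this

/-- **Tangent coordinates of a point at level `κ`.**  If `‖u‖ = 1` and `⟪v, u⟫ = κ` then the
frame coordinates `X = ⟪b₀, u⟫`, `Y = ⟪b₁, u⟫` satisfy `X² + Y² = 1 − κ²`. [folklore] -/
theorem sq_add_sq_of_inner_eq {u : EuclideanSpace ℝ (Fin 3)} (hu : ‖u‖ = 1) {κ : ℝ}
    (hvu : ⟪v, u⟫ = κ) :
    ⟪tangentFrame v hv 0, u⟫ ^ 2 + ⟪tangentFrame v hv 1, u⟫ ^ 2 = 1 - κ ^ 2 := by
  have h1 : ⟪u, u⟫ = 1 := by rw [real_inner_self_eq_norm_sq, hu]; norm_num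
  rw [inner_eq_sum_three (tangentFrame v hv), tangentFrame_two v hv, hvu] at h1
  nlinarith [h1]

/-- Polar form: `⟪b₀, u⟫ = r cos θ`, `⟪b₁, u⟫ = r sin θ` with `r = √(1 − κ²)`,
`θ = azimuth v u`. [folklore] -/
theorem inner_frame_eq_polar {u : EuclideanSpace ℝ (Fin 3)} (hu : ‖u‖ = 1) {κ : ℝ}
    (hvu : ⟪v, u⟫ = κ) :
    ⟪tangentFrame v hv 0, u⟫ = Real.sqrt (1 - κ ^ 2) * Real.cos (azimuth v hv u) ∧
      ⟪tangentFrame v hv 1, u⟫ = Real.sqrt (1 - κ ^ 2) * Real.sin (azimuth v hv u) :=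
  eq_sqrt_mul_cos_sin_arg (sq_add_sq_of_inner_eq hu hvu)

/-- **The inner product of two points at level `κ` in terms of their tangent angles**:
`⟪u, u'⟫ = (1 − κ²) cos (θ − θ') + κ²`. [cite: MusinTarasov2012, Proposition 3.3 (proof)] -/
theorem inner_eq_of_azimuth {u u' : EuclideanSpace ℝ (Fin 3)} (hu : ‖u‖ = 1) (hu' : ‖u'‖ = 1)
    {κ : ℝ} (hvu : ⟪v, u⟫ = κ) (hvu' : ⟪v, u'⟫ = κ) :
    ⟪u, u'⟫ = (1 - κ ^ 2) * Real.cos (azimuth v hv u - azimuth v hv u') + κ ^ 2 := by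
  have hκ : κ ^ 2 ≤ 1 := by
    have := abs_real_inner_le_norm v u
    rw [hv, hu, hvu, one_mul] at this
    have := abs_le.1 this
    nlinarith [this.1, this.2]
  have hR : 0 ≤ 1 - κ ^ 2 := by linarith
  have hcs := mul_add_mul_eq_mul_cos hR (sq_add_sq_of_inner_eq (hv := hv) hu hvu)
    (sq_add_sq_of_inner_eq (hv := hv) hu' hvu')
  rw [inner_eq_sum_three (tangentFrame v hv), tangentFrame_two v hv, hvu, hvu']
  unfold azimuth
  linarith [hcs]

/-- Two points at the same level `κ ∈ (−1, 1)` with the same tangent angle coincide.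
[folklore] -/
theorem eq_of_azimuth_eq {u u' : EuclideanSpace ℝ (Fin 3)} (hu : ‖u‖ = 1) (hu' : ‖u'‖ = 1)
    {κ : ℝ} (hvu : ⟪v, u⟫ = κ) (hvu' : ⟪v, u'⟫ = κ)
    (h : azimuth v hv u = azimuth v hv u') : u = u' := by
  obtain ⟨hX, hY⟩ := inner_frame_eq_polar (hv := hv) hu hvu
  obtain ⟨hX', hY'⟩ := inner_frame_eq_polar (hv := hv) hu' hvu'
  refine eq_of_inner_basis_eq (tangentFrame v hv) fun m => ?_
  fin_cases m
  · show ⟪tangentFrame v hv 0, u⟫ = ⟪tangentFrame v hv 0, u'⟫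
    rw [hX, hX', h]
  · show ⟪tangentFrame v hv 1, u⟫ = ⟪tangentFrame v hv 1, u'⟫
    rw [hY, hY', h]
  · show ⟪tangentFrame v hv 2, u⟫ = ⟪tangentFrame v hv 2, u'⟫
    rw [tangentFrame_two, hvu, hvu']

/-- **Pairing with a tangent direction**: `⟪t_φ, u⟫ = √(1 − κ²) cos (θ_u − φ)`. [folklore] -/
theorem inner_tangentDir {u : EuclideanSpace ℝ (Fin 3)} (hu : ‖u‖ = 1) {κ : ℝ} (hvu : ⟪v, u⟫ = κ)
    (φ : ℝ) :
    ⟪tangentDir v hv φ, u⟫ = Real.sqrt (1 - κ ^ 2) * Real.cos (azimuth v hv u - φ) := by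
  obtain ⟨hX, hY⟩ := inner_frame_eq_polar (hv := hv) hu hvu
  simp only [tangentDir, inner_add_left, real_inner_smul_left, hX, hY, Real.cos_sub]
  ring

end Frame

/-! ### Part C. The cyclic order of the contacts around a vertex and the gap angles -/

section Gaps

variable {N : ℕ}

/-- The set of tangent angles of the contact neighbours of `x i`. [folklore] -/
def nbrAngles (x : Fin N → EuclideanSpace ℝ (Fin 3)) (hx : ∀ k, ‖x k‖ = 1) (i : Fin N) : Finset ℝ :=
  (contactNbrs x i).image (fun j => azimuth (x i) (hx i) (x j))

/-- For an injective configuration the contact neighbours have pairwise distinct tangent angles,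
so there are exactly `deg(i)` of them. [folklore] -/
theorem card_nbrAngles {x : Fin N → EuclideanSpace ℝ (Fin 3)} (hx : ∀ k, ‖x k‖ = 1)
    (hinj : Function.Injective x) (i : Fin N) :
    (nbrAngles x hx i).card = (contactNbrs x i).card := by
  classical
  refine Finset.card_image_of_injOn fun j hj k hk hjk => ?_
  have hψ0 : 0 ≤ minDist x := minDist_nonneg x
  have hκ : ∀ l ∈ contactNbrs x i, ⟪x i, x l⟫ = 1 - minDist x ^ 2 / 2 := fun l hl =>
    (dist_eq_iff_inner_eq_of_unit (hx i) (hx l) hψ0).1 (mem_contactNbrs.1 hl).2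
  exact hinj (eq_of_azimuth_eq (hx j) (hx k) (hκ j hj) (hκ k hk) hjk)

/-- **The sorted tangent angles** `e₀ < e₁ < ⋯ < e_{d−1}` of the `d` contact neighbours of `x i`
(counter-clockwise order around `x i` in the tangent frame). [folklore] -/
def sortedAngle (x : Fin N → EuclideanSpace ℝ (Fin 3)) (hx : ∀ k, ‖x k‖ = 1) (i : Fin N) {d : ℕ}
    (hd : (nbrAngles x hx i).card = d) : Fin d ↪o ℝ :=
  (nbrAngles x hx i).orderEmbOfFin hd

/-- Each sorted angle is the tangent angle of some contact neighbour. [folklore] -/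
theorem exists_eq_sortedAngle {x : Fin N → EuclideanSpace ℝ (Fin 3)} (hx : ∀ k, ‖x k‖ = 1)
    (i : Fin N) {d : ℕ} (hd : (nbrAngles x hx i).card = d) (m : Fin d) :
    ∃ j ∈ contactNbrs x i, azimuth (x i) (hx i) (x j) = sortedAngle x hx i hd m := by
  have := (nbrAngles x hx i).orderEmbOfFin_mem hd m
  unfold nbrAngles at this
  rw [Finset.mem_image] at this
  obtain ⟨j, hj, he⟩ := this
  exact ⟨j, hj, he⟩

/-- Conversely every contact neighbour's angle occurs in the sorted list. [folklore] -/
theorem exists_sortedAngle_eq {x : Fin N → EuclideanSpace ℝ (Fin 3)} (hx : ∀ k, ‖x k‖ = 1)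
    (i : Fin N) {d : ℕ} (hd : (nbrAngles x hx i).card = d) {j : Fin N}
    (hj : j ∈ contactNbrs x i) :
    ∃ m : Fin d, sortedAngle x hx i hd m = azimuth (x i) (hx i) (x j) := by
  have hmem : azimuth (x i) (hx i) (x j) ∈ nbrAngles x hx i :=
    Finset.mem_image_of_mem _ hj
  have hrange := (nbrAngles x hx i).range_orderEmbOfFin hd
  have : azimuth (x i) (hx i) (x j) ∈ Set.range ((nbrAngles x hx i).orderEmbOfFin hd) := by
    rw [hrange]; exact hmem
  obtain ⟨m, hm⟩ := this
  exact ⟨m, hm⟩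

/-- **The gap angles** around `x i`: `g_m = e_{m+1} − e_m` for `m < d − 1` and the wrap-around
gap `g_{d−1} = 2π − (e_{d−1} − e₀)` — the angles at `x i` between cyclically consecutive
contact edges, i.e. the angles `uᵢ` of the faces of `CG` at the vertex `x i`.
[cite: MusinTarasov2012, §3.2 (the parameters uᵢ) and Proposition 3.6] -/
def gapAngle (x : Fin N → EuclideanSpace ℝ (Fin 3)) (hx : ∀ k, ‖x k‖ = 1) (i : Fin N) {k : ℕ}
    (hd : (nbrAngles x hx i).card = k + 1) (m : Fin (k + 1)) : ℝ :=
  sortedAngle x hx i hd (finRotate (k + 1) m) - sortedAngle x hx i hd m +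
    if m = Fin.last k then 2 * π else 0

/-- **Proposition 3.6 (iii) at a vertex: the gap angles sum to `2π`.**
[cite: MusinTarasov2012, Proposition 3.6 (iii)] -/
theorem sum_gapAngle {x : Fin N → EuclideanSpace ℝ (Fin 3)} (hx : ∀ k, ‖x k‖ = 1) (i : Fin N)
    {k : ℕ} (hd : (nbrAngles x hx i).card = k + 1) :
    ∑ m, gapAngle x hx i hd m = 2 * π := by
  unfold gapAngle
  rw [Finset.sum_add_distrib, Finset.sum_sub_distrib, Equiv.sum_comp (finRotate (k + 1))
    (fun m => sortedAngle x hx i hd m), sub_self, zero_add, Finset.sum_ite_eq']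
  simp

/-- The cosine of a gap is the cosine of the difference of the two consecutive sorted angles
(the `2π` of the wrap-around gap drops out). [folklore] -/
theorem cos_gapAngle {x : Fin N → EuclideanSpace ℝ (Fin 3)} (hx : ∀ k, ‖x k‖ = 1) (i : Fin N)
    {k : ℕ} (hd : (nbrAngles x hx i).card = k + 1) (m : Fin (k + 1)) :
    Real.cos (gapAngle x hx i hd m) =
      Real.cos (sortedAngle x hx i hd (finRotate (k + 1) m) - sortedAngle x hx i hd m) := by
  unfold gapAngle
  split_ifs
  · rw [Real.cos_add_two_pi]
  · rw [add_zero]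

/-- Every gap is positive and at most `2π` (all sorted angles lie in `(−π, π]`; the value `2π`
occurs only for a single neighbour). [folklore] -/
theorem gapAngle_pos {x : Fin N → EuclideanSpace ℝ (Fin 3)} (hx : ∀ k, ‖x k‖ = 1) (i : Fin N)
    {k : ℕ} (hd : (nbrAngles x hx i).card = k + 1) (m : Fin (k + 1)) :
    0 < gapAngle x hx i hd m ∧ gapAngle x hx i hd m ≤ 2 * π := by
  have hlo : ∀ m', -π < sortedAngle x hx i hd m' := fun m' => by
    obtain ⟨j, -, he⟩ := exists_eq_sortedAngle hx i hd m'
    rw [← he]; exact neg_pi_lt_azimuth _ _ _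
  have hhi : ∀ m', sortedAngle x hx i hd m' ≤ π := fun m' => by
    obtain ⟨j, -, he⟩ := exists_eq_sortedAngle hx i hd m'
    rw [← he]; exact azimuth_le_pi _ _ _
  have hmono := (sortedAngle x hx i hd).strictMono
  unfold gapAngle
  by_cases hm : m = Fin.last k
  · subst hm
    rw [if_pos rfl, finRotate_last]
    have h0 := hlo 0; have h1 := hhi (Fin.last k)
    have hle : sortedAngle x hx i hd 0 ≤ sortedAngle x hx i hd (Fin.last k) :=
      hmono.monotone (Fin.zero_le _)
    constructor <;> linarith
  · rw [if_neg hm, add_zero, finRotate_apply]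
    have hlt : m < Fin.last k := lt_of_le_of_ne (Fin.le_last m) hm
    have hlt' : m < m + 1 := Fin.lt_add_one_iff.2 hlt
    have h1 := hmono hlt'
    have h2 := hlo m; have h3 := hhi (m + 1)
    constructor <;> linarith

/-- **The neighbour at position `m`** in the counter-clockwise order around `x i`. [folklore] -/
def nbrAt (x : Fin N → EuclideanSpace ℝ (Fin 3)) (hx : ∀ k, ‖x k‖ = 1) (i : Fin N) {d : ℕ}
    (hd : (nbrAngles x hx i).card = d) (m : Fin d) : Fin N :=
  Classical.choose (exists_eq_sortedAngle hx i hd m)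

/-- It is a contact neighbour … [folklore] -/
theorem nbrAt_mem {x : Fin N → EuclideanSpace ℝ (Fin 3)} (hx : ∀ k, ‖x k‖ = 1) (i : Fin N)
    {d : ℕ} (hd : (nbrAngles x hx i).card = d) (m : Fin d) : nbrAt x hx i hd m ∈ contactNbrs x i :=
  (Classical.choose_spec (exists_eq_sortedAngle hx i hd m)).1

/-- … whose tangent angle is the `m`-th sorted angle. [folklore] -/
theorem azimuth_nbrAt {x : Fin N → EuclideanSpace ℝ (Fin 3)} (hx : ∀ k, ‖x k‖ = 1) (i : Fin N)
    {d : ℕ} (hd : (nbrAngles x hx i).card = d) (m : Fin d) :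
    azimuth (x i) (hx i) (x (nbrAt x hx i hd m)) = sortedAngle x hx i hd m :=
  (Classical.choose_spec (exists_eq_sortedAngle hx i hd m)).2

/-- `nbrAt` is injective (the sorted angles are distinct). [folklore] -/
theorem nbrAt_injective {x : Fin N → EuclideanSpace ℝ (Fin 3)} (hx : ∀ k, ‖x k‖ = 1) (i : Fin N)
    {d : ℕ} (hd : (nbrAngles x hx i).card = d) : Function.Injective (nbrAt x hx i hd) := by
  intro m m' h
  have := congrArg (fun j => azimuth (x i) (hx i) (x j)) h
  simp only [azimuth_nbrAt] at this
  exact (sortedAngle x hx i hd).injective this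

/-- Every contact neighbour is some `nbrAt m` (injective configurations). [folklore] -/
theorem exists_nbrAt_eq {x : Fin N → EuclideanSpace ℝ (Fin 3)} (hx : ∀ k, ‖x k‖ = 1)
    (hinj : Function.Injective x) (i : Fin N) {d : ℕ} (hd : (nbrAngles x hx i).card = d)
    {j : Fin N} (hj : j ∈ contactNbrs x i) : ∃ m : Fin d, nbrAt x hx i hd m = j := by
  obtain ⟨m, hm⟩ := exists_sortedAngle_eq hx i hd hj
  refine ⟨m, hinj ?_⟩
  have hψ0 : 0 ≤ minDist x := minDist_nonneg x
  have hκ : ∀ l ∈ contactNbrs x i, ⟪x i, x l⟫ = 1 - minDist x ^ 2 / 2 := fun l hl =>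
    (dist_eq_iff_inner_eq_of_unit (hx i) (hx l) hψ0).1 (mem_contactNbrs.1 hl).2
  exact eq_of_azimuth_eq (hx _) (hx j) (hκ _ (nbrAt_mem hx i hd m)) (hκ j hj)
    ((azimuth_nbrAt hx i hd m).trans hm)

end Gaps

/-! ### Part D. The bounds on the gap angles: `α(ψ) ≤ g < π` (Proposition 3.6 (i), (ii)) -/

section Bounds

variable {N : ℕ}

/-- **The cosine of a gap in terms of the two consecutive neighbours**:
`cos g_m = (⟪x_{j'}, x_j⟫ − κ²)/(1 − κ²)` with `κ = ⟪x i, x j⟫ = 1 − ψ²/2` (`0 < ψ < 2`).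
[cite: MusinTarasov2012, §3.2 (the angles uᵢ as functions of the configuration)] -/
theorem cos_gapAngle_eq {x : Fin N → EuclideanSpace ℝ (Fin 3)} (hx : ∀ k, ‖x k‖ = 1) (i : Fin N)
    {k : ℕ} (hd : (nbrAngles x hx i).card = k + 1) (hψ : 0 < minDist x) (hψ2 : minDist x < 2)
    (m : Fin (k + 1)) :
    Real.cos (gapAngle x hx i hd m) =
      (⟪x (nbrAt x hx i hd (finRotate (k + 1) m)), x (nbrAt x hx i hd m)⟫ -
        (1 - minDist x ^ 2 / 2) ^ 2) / (1 - (1 - minDist x ^ 2 / 2) ^ 2) := by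
  set κ := 1 - minDist x ^ 2 / 2 with hκdef
  have hκ₁ : κ < 1 := by rw [hκdef]; nlinarith
  have hκ₂ : -1 < κ := by rw [hκdef]; nlinarith
  have hD : 1 - κ ^ 2 ≠ 0 := by nlinarith
  have hψ0 : 0 ≤ minDist x := hψ.le
  have hκ : ∀ l ∈ contactNbrs x i, ⟪x i, x l⟫ = κ := fun l hl =>
    (dist_eq_iff_inner_eq_of_unit (hx i) (hx l) hψ0).1 (mem_contactNbrs.1 hl).2
  have h := inner_eq_of_azimuth (hv := hx i) (hx _) (hx _)
    (hκ _ (nbrAt_mem hx i hd (finRotate (k + 1) m))) (hκ _ (nbrAt_mem hx i hd m))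
  rw [azimuth_nbrAt, azimuth_nbrAt] at h
  rw [cos_gapAngle, eq_div_iff hD]
  linarith

/-- **Proposition 3.6 (ii) at a vertex: every gap is at least `α(ψ) = arccos (κ/(1 + κ))`**, the
angle of the regular spherical triangle of side `ψ` (`κ = cos ψ = 1 − ψ²/2` chordal; `0 < ψ < 2`).
For a single neighbour the gap is `2π`; otherwise the two consecutive neighbours are distinct
points at distance `≥ ψ`, so `cos g ≤ κ/(1+κ)` (`inner_tangentProj_le`).
[cite: MusinTarasov2012, Proposition 3.6 (ii)] -/
theorem arccos_le_gapAngle {x : Fin N → EuclideanSpace ℝ (Fin 3)} (hx : ∀ k, ‖x k‖ = 1)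
    (i : Fin N) {k : ℕ} (hd : (nbrAngles x hx i).card = k + 1) (hψ : 0 < minDist x)
    (hψ2 : minDist x < 2) (m : Fin (k + 1)) :
    Real.arccos ((1 - minDist x ^ 2 / 2) / (1 + (1 - minDist x ^ 2 / 2))) ≤
      gapAngle x hx i hd m := by
  set κ := 1 - minDist x ^ 2 / 2 with hκdef
  obtain ⟨hg0, hg2⟩ := gapAngle_pos hx i hd m
  by_cases hk : k = 0
  · -- one neighbour: the gap is `2π ≥ π ≥ arccos _`
    subst hk
    have hm : m = Fin.last 0 := Fin.ext (by have := m.2; simp only [Fin.val_last]; omega)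
    have : gapAngle x hx i hd m = 2 * π := by
      unfold gapAngle; rw [if_pos hm]
      have : finRotate (0 + 1) m = m :=
        Fin.ext (by have h1 := (finRotate (0 + 1) m).2; have h2 := m.2; omega)
      rw [this]; ring
    rw [this]
    linarith [Real.arccos_le_pi (κ / (1 + κ)), Real.pi_pos]
  -- at least two neighbours: consecutive ones are distinct
  have hκ₁ : κ < 1 := by rw [hκdef]; nlinarith
  have hκ₂ : -1 < κ := by rw [hκdef]; nlinarith
  have hψ0 : 0 ≤ minDist x := hψ.le
  have hne : finRotate (k + 1) m ≠ m := by
    intro h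
    have h1 := congrArg Fin.val h
    rw [finRotate_apply] at h1
    by_cases hml : m = Fin.last k
    · rw [hml, Fin.last_add_one] at h1
      simp at h1
      exact hk h1.symm
    · rw [Fin.val_add_one_of_lt (lt_of_le_of_ne (Fin.le_last m) hml)] at h1
      omega
  have hjj : nbrAt x hx i hd (finRotate (k + 1) m) ≠ nbrAt x hx i hd m :=
    fun h => hne (nbrAt_injective hx i hd h)
  have hinner : ⟪x (nbrAt x hx i hd (finRotate (k + 1) m)), x (nbrAt x hx i hd m)⟫ ≤ κ :=
    (le_dist_iff_inner_le_of_unit (hx _) (hx _) hψ0).1 (minDist_le_dist x hjj)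
  have hcos : Real.cos (gapAngle x hx i hd m) ≤ κ / (1 + κ) := by
    rw [cos_gapAngle_eq hx i hd hψ hψ2 m, div_le_div_iff₀ (by nlinarith) (by linarith)]
    nlinarith
  by_cases hgπ : gapAngle x hx i hd m ≤ π
  · calc Real.arccos (κ / (1 + κ)) ≤ Real.arccos (Real.cos (gapAngle x hx i hd m)) :=
          Real.arccos_le_arccos hcos
      _ = gapAngle x hx i hd m := Real.arccos_cos hg0.le hgπ
  · linarith [Real.arccos_le_pi (κ / (1 + κ))]

/-- **Proposition 3.6 (i) at a jammed vertex: every gap is `< π`.**  If `i` admits no shift,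
`ψ(x) < √2` and the gap `g_m` were `≥ π`, the tangent direction at azimuth `e_m + g_m/2` (the
bisector of the empty sector) would have all contacts in its closed negative half-plane —
`⟪t_φ, x j⟫ = √(1−κ²) cos(θ_j − φ)` with `θ_j − φ ∈ [g/2, 2π − g/2] ⊂ [π/2, 3π/2]` modulo `2π` —
and `hasShift_of_tangent_halfplane` would shift `i`.  ("all faces of `CG(X)` are convex polygons.
(Otherwise, a 'concave' vertex of a polygon `P` can be shifted to the interior of `P`.)")
[cite: MusinTarasov2012, Proposition 3.6 (i) and §3.2] -/
theorem gapAngle_lt_pi {x : Fin N → EuclideanSpace ℝ (Fin 3)} (hx : ∀ k, ‖x k‖ = 1)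
    {i : Fin N} (hns : ¬ HasShift x i)
    (hψ : minDist x < Real.sqrt 2) {k : ℕ} (hd : (nbrAngles x hx i).card = k + 1)
    (m : Fin (k + 1)) : gapAngle x hx i hd m < π := by
  by_contra hge
  push Not at hge
  have hψ0 : 0 ≤ minDist x := minDist_nonneg x
  set κ := 1 - minDist x ^ 2 / 2 with hκdef
  have hκ : ∀ l ∈ contactNbrs x i, ⟪x i, x l⟫ = κ := fun l hl =>
    (dist_eq_iff_inner_eq_of_unit (hx i) (hx l) hψ0).1 (mem_contactNbrs.1 hl).2
  set e := sortedAngle x hx i hd with hedef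
  set g := gapAngle x hx i hd m with hgdef
  obtain ⟨hg0, hg2⟩ := gapAngle_pos hx i hd m
  have hlo : ∀ m', -π < e m' := fun m' => by
    obtain ⟨j, -, he⟩ := exists_eq_sortedAngle hx i hd m'
    rw [hedef, ← he]; exact neg_pi_lt_azimuth _ _ _
  have hhi : ∀ m', e m' ≤ π := fun m' => by
    obtain ⟨j, -, he⟩ := exists_eq_sortedAngle hx i hd m'
    rw [hedef, ← he]; exact azimuth_le_pi _ _ _
  have hmono : StrictMono e := (sortedAngle x hx i hd).strictMono
  set φ := e m + g / 2 with hφdef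
  -- every contact lies in the closed half-plane `⟪t_φ, ·⟫ ≤ 0`
  have hhalf : ∀ j ∈ contactNbrs x i, ⟪tangentDir (x i) (hx i) φ, x j⟫ ≤ 0 := by
    intro j hj
    obtain ⟨k', hk'⟩ := exists_sortedAngle_eq hx i hd hj
    rw [inner_tangentDir (hx j) (hκ j hj), ← hk']
    have hr : 0 ≤ Real.sqrt (1 - κ ^ 2) := Real.sqrt_nonneg _
    refine mul_nonpos_of_nonneg_of_nonpos hr ?_
    change Real.cos (e k' - φ) ≤ 0
    -- locate `e k' - φ` in `[π/2, 3π/2]` modulo `2π`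
    by_cases hml : m = Fin.last k
    · -- wrap-around gap: `g = e 0 - e last + 2π`, all `e k' ∈ [e 0, e last]`
      have hgval : g = e 0 - e (Fin.last k) + 2 * π := by
        rw [hgdef]; unfold gapAngle; rw [if_pos hml, hml, finRotate_last]
      have h1 : e 0 ≤ e k' := hmono.monotone (Fin.zero_le _)
      have h2 : e k' ≤ e (Fin.last k) := hmono.monotone (Fin.le_last _)
      rw [← Real.cos_add_two_pi]
      apply Real.cos_nonpos_of_pi_div_two_le_of_le
      · rw [hφdef, hml]; linarith
      · rw [hφdef, hml]; linarith
    · have hlt : m < Fin.last k := lt_of_le_of_ne (Fin.le_last m) hml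
      have hgval : g = e (m + 1) - e m := by
        rw [hgdef]; unfold gapAngle; rw [if_neg hml, finRotate_apply, add_zero]
      have hval : (m + 1 : Fin (k + 1)).val = m.val + 1 := Fin.val_add_one_of_lt hlt
      rcases le_or_gt k' m with hkm | hkm
      · -- `e k' ≤ e m`
        have h1 : e k' ≤ e m := hmono.monotone hkm
        have h2 : -π < e k' := hlo k'
        have h3 : e (m + 1) ≤ π := hhi (m + 1)
        rw [← Real.cos_add_two_pi]
        apply Real.cos_nonpos_of_pi_div_two_le_of_le
        · rw [hφdef]; linarith
        · rw [hφdef]; linarith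
      · -- `e (m+1) ≤ e k'`
        have hle : m + 1 ≤ k' := by
          rw [Fin.le_iff_val_le_val, hval]; exact hkm
        have h1 : e (m + 1) ≤ e k' := hmono.monotone hle
        have h2 : e k' ≤ π := hhi k'
        have h3 : -π < e m := hlo m
        apply Real.cos_nonpos_of_pi_div_two_le_of_le
        · rw [hφdef]; linarith
        · rw [hφdef]; linarith
  obtain ⟨j, hj, hpos⟩ := exists_inner_pos_of_not_hasShift hx hns hψ (tangentDir_ne_zero φ)
    (inner_tangentDir_self φ)
  exact absurd (hhalf j hj) (not_le.2 hpos)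

/-- **The vertex star of a maximal arrangement with the fewest edges (`S²`, `N ≥ 7`)** — the
per-vertex content of Proposition 3.6: at a vertex of positive degree `d` (so `3 ≤ d ≤ 5`), the
`d` gap angles between cyclically consecutive contact edges satisfy `α(d_N) ≤ g_m < π` and
`Σ g_m = 2π`, where `cos α(d_N) = κ/(1+κ)`, `κ = 1 − d_N²/2` (chordal `cos d_N`).
[cite: MusinTarasov2012, Proposition 3.6 (i)–(iii)] -/
theorem IsTammesOptimal.gapAngle_bounds {x : Fin N → EuclideanSpace ℝ (Fin 3)} (hN : 7 ≤ N)
    (hopt : IsTammesOptimal N (EuclideanSpace ℝ (Fin 3)) x) {i : Fin N} {k : ℕ}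
    (hd : (nbrAngles x hopt.mem i).card = k + 1) :
    (∀ m, Real.arccos ((1 - minDist x ^ 2 / 2) / (1 + (1 - minDist x ^ 2 / 2))) ≤
        gapAngle x hopt.mem i hd m ∧ gapAngle x hopt.mem i hd m < π) ∧
      ∑ m, gapAngle x hopt.mem i hd m = 2 * π := by
  have hψ2 := hopt.minDist_lt_sqrt_two hN
  have hinj : Function.Injective x :=
    hopt.injective (by rw [finrank_euclideanSpace_fin]; omega) (by omega)
  have hψ : 0 < minDist x :=
    hopt.minDist_pos (by rw [finrank_euclideanSpace_fin]; omega) (by omega)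
  have h2 : minDist x < 2 := by
    have : Real.sqrt 2 < 2 := by
      rw [show (2 : ℝ) = Real.sqrt 4 by
        rw [show (4 : ℝ) = 2 ^ 2 by norm_num, Real.sqrt_sq (by norm_num)]]
      exact Real.sqrt_lt_sqrt (by norm_num) (by norm_num)
    linarith
  have hdeg : (contactNbrs x i).Nonempty := by
    rw [← Finset.card_pos, ← card_nbrAngles hopt.mem hinj i, hd]; exact Nat.succ_pos k
  obtain ⟨j, hj⟩ := hdeg
  have hns : ¬ HasShift x i := hopt.not_hasShift ⟨j, mem_contactNbrs_iff.1 hj⟩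
  exact ⟨fun m => ⟨arccos_le_gapAngle hopt.mem i hd hψ h2 m,
    gapAngle_lt_pi hopt.mem hns hψ2 hd m⟩, sum_gapAngle hopt.mem i hd⟩

end Bounds

end Literature.Geometry.DiscreteGeometry

end
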